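import Summits.CriticalPhenomena.PercolationContinuityZ3.Theorems.PercNearOneGluingNoHeavyQuantForestData
import Summits.CriticalPhenomena.PercolationContinuityZ3.Theorems.PercNearOneGluingNoHeavyQuantGatedSliceMixLawNodeHolds
import Summits.CriticalPhenomena.PercolationContinuityZ3.Theorems.PercNearOneGluingNoHeavyQuantGateMoveBlobCells
import Summits.CriticalPhenomena.PercolationContinuityZ3.Theorems.PercNearOneGluingNoHeavyQuantDECAtTMixtures
import HarnessLib

/-!
# QUANT lane R8, T-DEC: THE ATOMIC RE-GATING THEOREM, k-GENERAL (arm-1 g46's identity in the list binder, law level) —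
# a forest of `k` gated trees with root relays, under an outer gate `a` with `a·S ≤ Σ qᵢrᵢ`, is DEC at every layer:
# `gate_a(∗ᵢ gate_{qᵢ}ρᵢ) = Σ_m w_m · gate_{g_m}(∗ᵢ gate_{qᵢ}δ_{mᵢ})`, every component a gated BLOB forest (SDEC by CW)

builds on p205010 (kernel theorem, internal audit signed; external expert review pending)

Support file (`--supports stmt-CriticalPhenomena-4575`), QUANT lane typer seat prim-quant-stmt (gen 39), rung R8 of
`run/shared/lean/prim/quant/LADDER.md`.  Theorems only, standard axioms, no sorries.  The identity is prim-quant-arm-1 g46's ATOMIC (VERSION)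
RE-GATING IDENTITY (INBOX l.1593, ARCH-LIGHT-G46 §10; cross-checked exactly by census-2 g71, TIED3-G71 §0.9); arm-1 lands the `k = 3`
instance (`…ThreeRootAtomicRegating`), this file the `k`-general law-level theorem over typer g39's list binder `…QuantForestData`
(`Sib`, `flaw`, `fmean`, `sigmaR`, `sigmaM`, `qmin`).  Uses the lane's CW (`sdec_slice_blob_of_mixLaw'` + ✓ `gatedSliceMixLaw'_holds`),
`decAtT_mixture_finset`, `decAt_of_top_le` (Theorem A), `decAtT_mono_top`, `decAt_mono_floor`.

THE IDENTITY.  For siblings `tᵢ = gate_{qᵢ} ρᵢ` (`ρᵢ` a probability law on `{0..Mᵢ}` with a ROOT RELAY, `ρᵢ 0 = 0`), write `ρᵢ = Σ_m ρᵢ(m)·δ_m`;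
by multilinearity the forest law is a mixture over atom vectors `m` of BLOB-forest laws `B_m = ∗ᵢ gate_{qᵢ} δ_{mᵢ}` with weights
`π_m = Πᵢ ρᵢ(mᵢ)`; re-gating every piece to the common target `a·S` (`S = Σ qᵢ·mean ρᵢ`): `gate_a(∗ᵢ tᵢ) = Σ_m w_m·gate_{g_m} B_m`,
`g_m = a·S/σ_m`, `w_m = π_m·σ_m/S`, `σ_m = Σᵢ qᵢ mᵢ = mean B_m` — valid (`g_m ≤ 1`) iff `a·S ≤ min_m σ_m = Σᵢ qᵢ rᵢ`, `rᵢ` the least charged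
atom of `ρᵢ`.  Every component is a gated blob forest, SDEC by the slice theorems — NO induction hypothesis on composite forests is used.

* **`flaw_atomic`** (THE ATOMIC MIXTURE: `flaw L = Σᵢ πᵢ·Bᵢ`, each `Bᵢ` on `{0..tᵢ}`, `tᵢ ≤ ftop L`, mean `σᵢ ≤ sigmaM L` (`≥ sigmaR L` when charged),
  `qmin·tᵢ ≤ σᵢ`, and SDEC at EVERY floor `y ≤ qmin L` — by CW; `Σ πᵢσᵢ = fmean L`);
* **`decAt_gate_flaw_atomic`** (THE THEOREM): `LawOK`, root relays, `0 < x`, `0 < a`, `a·fmean L ≤ sigmaR L` (atomic regime), `x·sigmaM L ≤ fmean L·qmin L`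
  (floor check) ⟹ `DECAt (a·x) j (ftop L) (gate (flaw L) a)` for every `j < ftop L`;
* **`sdecUpTo_flaw_atomic`**: under the floor check, `SDECUpTo x (sigmaR L / fmean L) (ftop L) (flaw L)`.

READING (README V400 format): an explicit RCM certificate family for EVERY width `k` and every box structure on the outer-gate range
`a ≤ Σqᵢrᵢ / Σqᵢ Sᵢ` (for 2-chain siblings `≥ 1/2` always; coverage k = 3/4/5 identical, arm-1 explore/versions.py), with the floor check
holding in ≈ 98 % of the census; complementary to identity I (✓ p395998, large `a`).  HONEST STATUS: this does NOT close `SiblingStep`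
(large outer gates remain); `SiblingStep`, `GateStepN`, `FarTreeRow` OPEN; RATE class log\* / honest sentence unchanged.
[this work]; identity: prim-quant-arm-1 g46; cross-check: prim-quant-census-2 g71; CW: this lane.  Nothing here is cited as a published result.
The gluing rows served [cite: KozmaNitzan2024, Conjecture 3 (p. 15)]; product measure [cite: Grimmett1999, §1.3 p. 10].
-/

noncomputable section

open scoped BigOperators

namespace Summit.CriticalPhenomena.PercolationContinuityZ3.Theorems
namespace Quant
namespace LawDec

open Finset

/-! ### The atomic mixture -/

/-- **THE ATOMIC MIXTURE of a forest of gated trees with root relays.**  `flaw L` is a finite mixture `Σᵢ πᵢ·Bᵢ` of laws `Bᵢ` (the blob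
forests `∗ⱼ gate_{qⱼ} δ_{mⱼ}` over atom vectors `m`), each on `{0..tᵢ}` with `tᵢ ≤ ftop L`, nonnegative of mass `1` and mean `σᵢ ≤ sigmaM L`,
`qmin L·tᵢ ≤ σᵢ`, SDEC at EVERY floor `0 < y ≤ qmin L`, `y < 1` (by CW); the charged components (`πᵢ > 0`) have `sigmaR L ≤ σᵢ`; and
`Σ πᵢσᵢ = fmean L`. [this work] -/
theorem flaw_atomic (L : List Sib) (hL : ∀ s ∈ L, s.LawOK) (h0 : ∀ s ∈ L, s.ρ 0 = 0) :
    ∃ (ι : Type) (_ : Fintype ι) (π : ι → ℝ) (t : ι → ℕ) (σ : ι → ℝ) (B : ι → ℕ → ℝ),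
      (∀ i, 0 ≤ π i) ∧ (∑ i, π i = 1) ∧ (∀ h, flaw L h = ∑ i, π i * B i h) ∧ (∑ i, π i * σ i = fmean L) ∧
      (∀ i, t i ≤ ftop L ∧ (∀ h, 0 ≤ B i h) ∧ (∀ h, t i < h → B i h = 0) ∧ (∑ h ∈ Finset.range (t i + 1), B i h = 1) ∧
        (∑ h ∈ Finset.range (t i + 1), (h : ℝ) * B i h = σ i) ∧ σ i ≤ sigmaM L ∧ qmin L * (t i : ℝ) ≤ σ i ∧
        (∀ y : ℝ, 0 < y → y ≤ qmin L → y < 1 → SDEC y (t i) (B i))) ∧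
      (∀ i, 0 < π i → sigmaR L ≤ σ i) := by
  classical
  induction L with
  | nil =>
    refine ⟨Unit, inferInstance, fun _ => 1, fun _ => 0, fun _ => 0, fun _ => fun h => if h = 0 then (1 : ℝ) else 0,
      fun _ => zero_le_one, by simp, fun h => by simp [flaw], by simp [fmean], fun _ => ⟨le_rfl, fun h => ?_,
      fun h hh => if_neg (by dsimp only at hh; omega),
      by simp, by simp, by simp [sigmaM], by simp, fun y _ _ _ => ?_⟩, fun _ _ => by simp [sigmaR]⟩
    · beta_reduce; split_ifs <;> norm_num
    · intro q _ _ j' hj; dsimp only at hj; omega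
  | cons s L ih =>
    have hs := hL s List.mem_cons_self
    have hsL : ∀ t ∈ L, t.LawOK := fun t ht => hL t (List.mem_cons_of_mem s ht)
    obtain ⟨hq0, hq1, ρ0, ρM, ρ1⟩ := hs
    obtain ⟨ι, _, π, t, σ, B, hπ0, hπ1, hmix, hπσ, hB, hsigmaR⟩ := ih hsL (fun t ht => h0 t (List.mem_cons_of_mem s ht))
    obtain ⟨hqm0, hqm1, hqmle, _⟩ := qmin_facts L hsL
    -- new index: an atom `a ≤ s.M` of the new sibling and an old component
    refine ⟨Fin (s.M + 1) × ι, inferInstance, fun p => s.ρ p.1 * π p.2, fun p => t p.2 + p.1, fun p => σ p.2 + s.q * ((p.1 : ℕ) : ℝ),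
      fun p => slice (B p.2) p.1 s.q, fun p => mul_nonneg (ρ0 _) (hπ0 _), ?_, ?_, ?_, ?_, ?_⟩
    · -- total weight
      simp only [Fintype.sum_prod_type]
      simp_rw [← Finset.mul_sum, hπ1, mul_one]
      rw [Fin.sum_univ_eq_sum_range (fun a => s.ρ a) (s.M + 1), ρ1]
    · -- the mixture identity
      intro h
      simp only [flaw, Fintype.sum_prod_type]
      have e1 : flaw L = fun k => ∑ i, π i * B i k := funext hmix
      have e2 : gate s.ρ s.q = fun k => ∑ a ∈ Finset.range (s.M + 1), s.ρ a * gate (fun h => if h = a then (1 : ℝ) else 0) s.q k :=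
        funext (gate_eq_sum_atoms s.M s.ρ s.q ρM ρ1)
      rw [e1, lconv_fsum_left, Finset.sum_comm]
      refine Finset.sum_congr rfl fun i _ => ?_
      rw [e2, lconv_fsum_right, Finset.mul_sum, Finset.sum_range]
      refine Finset.sum_congr rfl fun a _ => ?_
      have ha : (a : ℕ) ≤ s.M := Nat.lt_succ_iff.1 a.isLt
      have hBt : ∀ k, ftop L < k → B i k = 0 := fun k hk => (hB i).2.2.1 k (lt_of_le_of_lt (hB i).1 hk)
      have hδ : ∀ k, (a : ℕ) < k → gate (fun h => if h = (a : ℕ) then (1 : ℝ) else 0) s.q k = 0 := by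
        intro k hk; rw [gate_apply, if_neg (by omega), if_neg (by omega)]; ring
      rw [lconv_top_right_of_le (ftop L) a s.M _ _ ha hδ, lconv_gate_point_eq_slice (ftop L) a (B i) s.q hBt]
      ring
    · -- `Σ πσ = fmean`
      simp only [fmean, Fintype.sum_prod_type]
      have e : ∀ a : Fin (s.M + 1), ∑ i, s.ρ a * π i * (σ i + s.q * ((a : ℕ) : ℝ))
          = s.ρ a * (∑ i, π i * σ i) + (s.q * (((a : ℕ) : ℝ) * s.ρ a)) * ∑ i, π i := by
        intro a; rw [Finset.mul_sum, Finset.mul_sum, ← Finset.sum_add_distrib]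
        exact Finset.sum_congr rfl fun i _ => by ring
      rw [Finset.sum_congr rfl fun a _ => e a]
      simp_rw [hπσ, hπ1, mul_one]
      rw [Finset.sum_add_distrib, ← Finset.sum_mul, ← Finset.mul_sum,
        Fin.sum_univ_eq_sum_range (fun a => s.ρ a) (s.M + 1), ρ1, one_mul,
        Fin.sum_univ_eq_sum_range (fun a => ((a : ℕ) : ℝ) * s.ρ a) (s.M + 1)]
      rfl
    · -- component facts
      rintro ⟨a, i⟩
      dsimp only
      obtain ⟨hti, Bi0, BiM, Bi1, Bimean, hsigmaMi, hqt, hS⟩ := hB i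
      have ha : (a : ℕ) ≤ s.M := Nat.lt_succ_iff.1 a.isLt
      refine ⟨by simp only [ftop]; omega, fun h => slice_nonneg _ _ _ hq0.le hq1.le Bi0 h,
        fun h hh => slice_eq_zero _ _ _ _ BiM h hh, sum_slice _ _ _ _ BiM Bi1, ?_, ?_, ?_, ?_⟩
      · rw [sum_mul_slice _ _ _ _ BiM Bi1, Bimean]; ring
      · simp only [sigmaM]
        have : s.q * ((a : ℕ) : ℝ) ≤ s.q * (s.M : ℝ) := mul_le_mul_of_nonneg_left (by exact_mod_cast ha) hq0.le
        linarith
      · simp only [qmin, Nat.cast_add]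
        have h1 : min s.q (qmin L) * (t i : ℝ) ≤ qmin L * (t i : ℝ) :=
          mul_le_mul_of_nonneg_right (min_le_right _ _) (Nat.cast_nonneg _)
        have h2 : min s.q (qmin L) * ((a : ℕ) : ℝ) ≤ s.q * ((a : ℕ) : ℝ) :=
          mul_le_mul_of_nonneg_right (min_le_left _ _) (Nat.cast_nonneg _)
        have h3 : min s.q (qmin L) * ((t i : ℝ) + ((a : ℕ) : ℝ)) = min s.q (qmin L) * (t i : ℝ) + min s.q (qmin L) * ((a : ℕ) : ℝ) :=
          mul_add _ _ _
        linarith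
      · intro y hy0 hyq hy1
        simp only [qmin] at hyq
        have hyL : y ≤ qmin L := hyq.trans (min_le_right _ _)
        have hSB : SDEC y (t i) (B i) := hS y hy0 hyL hy1
        rcases Nat.eq_zero_or_pos (a : ℕ) with ha0 | ha0
        · rw [ha0, slice_zero_size, Nat.add_zero]; exact hSB
        · have hta : y * (t i : ℝ) ≤ ∑ h ∈ Finset.range (t i + 1), (h : ℝ) * B i h := by
            rw [Bimean]; nlinarith [mul_le_mul_of_nonneg_right hyL (Nat.cast_nonneg (t i))]
          exact sdec_slice_blob_of_mixLaw' gatedSliceMixLaw'_holds y s.q (t i) a (B i) hy0 hy1 (hyq.trans (min_le_left _ _)) hq1.le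
            ha0 Bi0 BiM Bi1 hta hSB
    · -- charged components dominate `sigmaR`
      rintro ⟨a, i⟩ hp
      dsimp only at hp ⊢
      have hρa : s.ρ a ≠ 0 := by
        intro hz; rw [hz, zero_mul] at hp; exact lt_irrefl _ hp
      have hπi : 0 < π i := by
        rcases (hπ0 i).eq_or_lt with hz | hlt
        · rw [← hz, mul_zero] at hp; exact absurd hp (lt_irrefl _)
        · exact hlt
      have hra : s.r ≤ (a : ℕ) := s.r_le hρa
      simp only [sigmaR]
      have : s.q * (s.r : ℝ) ≤ s.q * ((a : ℕ) : ℝ) := mul_le_mul_of_nonneg_left (by exact_mod_cast hra) hq0.le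
      linarith [hsigmaR i hπi]

/-! ### The theorem -/

/-- **THE ATOMIC RE-GATING THEOREM (k-general; arm-1 g46's identity).**  For a forest of gated trees with root relays (`LawOK`, `ρᵢ 0 = 0`)
at a floor `0 < x`, and an outer gate `0 < a` in the ATOMIC REGIME `a·fmean L ≤ sigmaR L` (every re-gate `g_m = a·S/σ_m ≤ 1`) satisfying the
FLOOR CHECK `x·sigmaM L ≤ fmean L·qmin L` (every component's floor `g_m·qmin ≥ a·x`), the gated forest law `gate (flaw L) a` is DEC at every
layer `j < ftop L` at floor `a·x` — certified by the mixture `Σ_m w_m·gate_{g_m} B_m` of re-gated blob forests. [this work] -/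
theorem decAt_gate_flaw_atomic (L : List Sib) (hL : ∀ s ∈ L, s.LawOK) (h0 : ∀ s ∈ L, s.ρ 0 = 0) {x a : ℝ}
    (hx0 : 0 < x) (ha0 : 0 < a) (hreg : a * fmean L ≤ sigmaR L) (hfl : x * sigmaM L ≤ fmean L * qmin L) :
    ∀ j, j < ftop L → DECAt (a * x) j (ftop L) (gate (flaw L) a) := by
  classical
  intro j hj
  have hne : L ≠ [] := by rintro rfl; simp [ftop] at hj
  obtain ⟨hqm0, _, _, hqlt⟩ := qmin_facts L hL
  have hy1 : qmin L < 1 := hqlt hne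
  obtain ⟨_, _, _, fmn⟩ := flaw_facts L hL
  obtain ⟨_, hsigmaRf, hsigmaRp⟩ := sigmaR_facts L hL h0
  obtain ⟨ι, _, π, t, σ, B, hπ0, hπ1, hmix, hπσ, hB, hsigmaR⟩ := flaw_atomic L hL h0
  set S : ℝ := fmean L with hSdef
  have hS0 : 0 < S := lt_of_lt_of_le (hsigmaRp hne) hsigmaRf
  have haS : 0 < a * S := mul_pos ha0 hS0
  have hσpos : ∀ i, 0 < π i → 0 < σ i := fun i hi => lt_of_lt_of_le (lt_of_lt_of_le haS hreg) (hsigmaR i hi)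
  -- weights and re-gates
  set w : ι → ℝ := fun i => π i * σ i / S with hw
  set g : ι → ℝ := fun i => a * S / σ i with hg
  have hwg : ∀ i, w i * g i = a * π i := by
    intro i
    rcases (hπ0 i).eq_or_lt with hz | hpos
    · show π i * σ i / S * (a * S / σ i) = a * π i
      rw [← hz]; ring
    · show π i * σ i / S * (a * S / σ i) = a * π i
      field_simp [(hσpos i hpos).ne', hS0.ne']
  have hw0 : ∀ i, 0 ≤ w i := by
    intro i
    rcases (hπ0 i).eq_or_lt with hz | hpos
    · show 0 ≤ π i * σ i / S
      rw [← hz, zero_mul, zero_div]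
    · exact div_nonneg (mul_nonneg hpos.le (hσpos i hpos).le) hS0.le
  have hw1 : ∑ i, w i = 1 := by
    show ∑ i, π i * σ i / S = 1
    rw [← Finset.sum_div, hπσ, div_self hS0.ne']
  -- the pointwise identity `gate (flaw L) a = Σ w · gate B g`
  have hident : ∀ h, gate (flaw L) a h = ∑ i, w i * gate (B i) (g i) h := by
    intro h
    have e : ∀ i, w i * gate (B i) (g i) h = a * (π i * B i h) + (if h = 0 then (1 : ℝ) else 0) * (w i - a * π i) := by
      intro i
      rw [gate_apply, mul_add, ← mul_assoc, hwg i]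
      have : w i * ((1 - g i) * (if h = 0 then (1 : ℝ) else 0)) = (if h = 0 then (1 : ℝ) else 0) * (w i - w i * g i) := by ring
      rw [this, hwg i]; ring
    rw [Finset.sum_congr rfl fun i _ => e i, Finset.sum_add_distrib, ← Finset.mul_sum, ← Finset.mul_sum, Finset.sum_sub_distrib,
      ← Finset.mul_sum, hw1, hπ1, ← hmix h, gate_apply]
    ring
  -- every charged component is DEC at `(a·x, a·S, j)` on `{0..ftop}`
  have hcomp : ∀ i, 0 < w i → DECAtT (a * x) (a * S) j (ftop L) (gate (B i) (g i)) := by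
    intro i hwi
    have hπi : 0 < π i := by
      by_contra hle
      have hz : π i = 0 := le_antisymm (not_lt.1 hle) (hπ0 i)
      have : w i = 0 := by show π i * σ i / S = 0; rw [hz, zero_mul, zero_div]
      rw [this] at hwi; exact lt_irrefl _ hwi
    obtain ⟨hti, Bi0, BiM, Bi1, Bimean, hsigmaMi, hqt, hSi⟩ := hB i
    have hσi := hσpos i hπi
    have hg0 : 0 < g i := div_pos haS hσi
    have hg1 : g i ≤ 1 := by
      show a * S / σ i ≤ 1
      rw [div_le_one hσi]; exact hreg.trans (hsigmaR i hπi)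
    have hgσ : g i * σ i = a * S := by
      show a * S / σ i * σ i = a * S
      exact div_mul_cancel₀ _ hσi.ne'
    -- the blob forest at floor `y = qmin`, gated: SDEC at `g·qmin ≥ a·x`
    have hSB : SDEC (g i * qmin L) (t i) (gate (B i) (g i)) := sdec_gate (hSi (qmin L) hqm0 le_rfl hy1) (g i) hg0 hg1
    have hfloor : a * x ≤ g i * qmin L := by
      show a * x ≤ a * S / σ i * qmin L
      rw [div_mul_eq_mul_div, le_div_iff₀ hσi]
      have h1 : a * (x * σ i) ≤ a * (S * qmin L) :=
        mul_le_mul_of_nonneg_left ((mul_le_mul_of_nonneg_left hsigmaMi hx0.le).trans hfl) ha0.le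
      linarith
    have hgq1 : g i * qmin L < 1 := by nlinarith
    have hax1 : a * x < 1 := lt_of_le_of_lt hfloor hgq1
    -- facts of the gated component
    have G0 : ∀ h, 0 ≤ gate (B i) (g i) h := by
      intro h; simp only [LawDec.gate]; split_ifs <;> nlinarith [Bi0 h]
    have GM : ∀ h, t i < h → gate (B i) (g i) h = 0 := by
      intro h hh; simp only [LawDec.gate]; rw [BiM h hh, if_neg (by omega)]; ring
    have G1 : ∑ h ∈ Finset.range (t i + 1), gate (B i) (g i) h = 1 := sum_gate _ _ _ Bi1
    have Gmean : ∑ h ∈ Finset.range (t i + 1), (h : ℝ) * gate (B i) (g i) h = a * S := by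
      rw [sum_mul_gate, Bimean, hgσ]
    have Gta : ∀ h, 0 < gate (B i) (g i) h →
        (a * x) * (h : ℝ) ≤ ∑ k ∈ Finset.range (t i + 1), (k : ℝ) * gate (B i) (g i) k := by
      intro h hh
      rw [Gmean]
      have hht : h ≤ t i := by
        by_contra hlt; exact absurd (GM h (not_le.1 hlt)) hh.ne'
      have h1 : (a * x) * (h : ℝ) ≤ (a * x) * (t i : ℝ) := mul_le_mul_of_nonneg_left (by exact_mod_cast hht) (by positivity)
      have h2 : (a * x) * (t i : ℝ) ≤ (g i * qmin L) * (t i : ℝ) := mul_le_mul_of_nonneg_right hfloor (Nat.cast_nonneg _)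
      have h3 : g i * (qmin L * (t i : ℝ)) ≤ g i * σ i := mul_le_mul_of_nonneg_left hqt hg0.le
      nlinarith
    have hall : DECAt (a * x) j (t i) (gate (B i) (g i)) := by
      by_cases hlt : j < t i
      · have hd := hSB 1 one_pos le_rfl j hlt
        rw [gate_one, one_mul] at hd
        exact decAt_mono_floor hfloor hgq1 hd
      · exact decAt_of_top_le (t i) _ G0 GM G1 (a * x) hax1 Gta j (not_lt.1 hlt)
    rw [decAt_iff_decAtT, Gmean] at hall
    exact decAtT_mono_top hall hti
  -- assemble
  have hmeanG : ∑ h ∈ Finset.range (ftop L + 1), (h : ℝ) * gate (flaw L) a h = a * S := by rw [sum_mul_gate, fmn]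
  rw [decAt_iff_decAtT, hmeanG]
  exact decAtT_congr (fun h => (hident h).symm)
    (decAtT_mixture_finset Finset.univ w (fun i => gate (B i) (g i)) (fun i _ => hw0 i) hw1 (fun i _ hwi => hcomp i hwi))

/-- **COROLLARY: SDEC UP TO THE ATOMIC THRESHOLD** — under the floor check, the forest law is `SDECUpTo x (sigmaR L / fmean L)`: DEC at every
layer for every outer gate `a ≤ Σqᵢrᵢ / Σqᵢ Sᵢ`. [this work] -/
theorem sdecUpTo_flaw_atomic (L : List Sib) (hL : ∀ s ∈ L, s.LawOK) (h0 : ∀ s ∈ L, s.ρ 0 = 0) {x : ℝ}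
    (hx0 : 0 < x) (hfl : x * sigmaM L ≤ fmean L * qmin L) : SDECUpTo x (sigmaR L / fmean L) (ftop L) (flaw L) := by
  intro a ha0 ha j hj
  have hne : L ≠ [] := by rintro rfl; simp [ftop] at hj
  obtain ⟨_, hsigmaRf, hsigmaRp⟩ := sigmaR_facts L hL h0
  have hS0 : 0 < fmean L := lt_of_lt_of_le (hsigmaRp hne) hsigmaRf
  have hreg : a * fmean L ≤ sigmaR L := by
    have := mul_le_mul_of_nonneg_right ha hS0.le
    rwa [div_mul_cancel₀ _ hS0.ne'] at this
  exact decAt_gate_flaw_atomic L hL h0 hx0 ha0 hreg hfl j hj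

end LawDec
end Quant
end Summit.CriticalPhenomena.PercolationContinuityZ3.Theorems
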